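import Summits.QuantumAdvantage.AdviceFreeQNC0.LinearSelections
import Summits.QuantumAdvantage.AdviceFreeQNC0.CleanGapStrategies
import Summits.QuantumAdvantage.QuantumAdvantage.Theses.OddPrimeWalk
import Summits.QuantumAdvantage.QuantumAdvantage.Theorems.CharDialJLinVPECore
import Summits.QuantumAdvantage.AdviceFreeQNC0.LogDegreeResidueBalance
import Literature.Computability.MetaComplexity.TwoModuliExpSums
import HarnessLib

/-!
# RankDial (A) — the 𝔽_p-RANK LADDER of a silent window on rung R5 (decomp-qadv lens-1 «grading / quantitative ladder», g25), part 1/4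

TARGET BY NAME (cell decomp-qadv, RESIDUAL MODE): item stmt-QuantumAdvantage-23109
`Summit.QuantumAdvantage.QuantumAdvantage.Theses.OddPrimeWalk.ManyReadersSqrtOdd` (=: T), reached through rung R5 =
`AdviceFreeQNC0.WalkHardFLinSel p` (`T → ∀ p ≥ 5, R5 p`, tree `JLinPeel`).  These files SUPPORT the item (`--supports`); they do not close it.

THE OBJECT.  A strategy `y` of α's u-walk game on `n = L+ℓ+R` bits has a CUT-FREE WINDOW `[L, L+ℓ)` if no cut strictly inside the window
ever fires (`CutFree`, = the tree's `hgap` without `hloc`).  The window is graded by the **𝔽_p-sketch dimension of its view**: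
`RankLE p y d` :⟺ there is ONE matrix `Φ ∈ 𝔽_p^(d'×ℓ)`, `d' ≤ d`, such that on every outside fibre `(a,b)` every selector
`v ↦ y_g(a ++ v ++ b)` is some function of `Φv` (tables arbitrary, any number of cuts may read the window).  Under `LinSel` the readers'
window forms are such a sketch (`rankLE_of_linSel`, this part), so the rank grade contains g24's readership grade — strictly (part D).

THE LAW `EquiRank p r`: for `ℓ ≥ ℓ₀`, every level set of EVERY function `G : 𝔽_p^d → Bool` of a rank-`≤ r(ℓ)` sketch is
1/8-equidistributed over the Hamming weight mod 3 (`24·#{v : |v| ≡ b, G(Φv) = s} ≤ 8·#{v : G(Φv) = s} + 2^ℓ`).  The dial is the rank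
fraction: `EquiRankLin p` (rank `ℓ/E`, PROVED for every `p` coprime to 3 in part C), `EquiRankSharp p` (every `D > p−1`, UNDECIDED),
and the law FAILS at rank `ℓ/(p−1)` (part D, the block sketch = Olson's extremal Davenport sequence of `ℤ_p^d`); `ExactRankBound p`
(an exact sketch for `|v| mod 3` has `ℓ ≤ (p−1)·d`; tight, part D) is the typed first open rung (UNDECIDED, exhaustively verified for
six `(p,d)` by the lens).

THIS PART: §1 the law and its rungs as `Prop`s (`EquiRank`, `EquiRankLin`, `EquiRankSharp`, `ExactRankBound`, `equiRank_mono`);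
§2 window vocabulary (`CutFree`, `Reads`, `readers`, `not_reads` [g24], `RankLE`, `rankLE_mono`); §2bis the walk-game PIECES
`WindowRankLinSel` (PROVED ∀ primes `p ≥ 5` in part C), `WindowRankSel` (arbitrary tables), `WindowHighRankLinSel`, `NoWindowLinSel`,
the g24 pieces `WindowFewLinSel` / `WindowDenseLinSel` for comparison, `R5Odd`, the declared residual `R5LiftOdd`; §3bis readership is a
sketch (`linForm_glue3`, `lamW`, `rhoW`, `linSel_glue3` [g24], `rankLE_of_linSel`, `rankLE_of_readers_le`, `readers_gt_of_not_rankLE`).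
Parts: B = the fibre theorem for general tables; C = the rung `equiRank_of_coprime` + the frame (`windowRankLinSel_holds`, `closes` BY NAME,
`target_iff_residual`, `r5_residual`); D = strictness of the rank grade + the ceiling `not_equiRank_block`.
Every part: farm `lean check` rc 0 · 0 sorry · no `native_decide` / `instance` / notation; axioms {propext, Classical.choice, Quot.sound}.
-/

set_option linter.dupNamespace false
set_option autoImplicit false

noncomputable section
open Classical

namespace Summit.QuantumAdvantage.QuantumAdvantage.Theorems.RankDial

open Finset
open Summit.QuantumAdvantage.AdviceFreeQNC0

/-! ### §1 The law: level sets of functions of a low-rank 𝔽_p-sketch are equidistributed mod 3 -/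

section Law
variable {p : ℕ}

/-- **The law at rank `r`.**  For all large `ℓ`, every `d ≤ r(ℓ)`, every sketch `Φ ∈ 𝔽_p^{d × ℓ}` and EVERY
`G : 𝔽_p^d → Bool`: each level set of `G ∘ Φ` on `{0,1}^ℓ` is `1/8`-equidistributed over `|v| mod 3`,
`24·#{v : |v| ≡ b, G(Φv) = s} ≤ 8·#{v : G(Φv) = s} + 2^ℓ`.  [PROVED at `r(ℓ) = ℓ/E` (§4); FALSE at
`r(ℓ) = ℓ/(p−1)` (§5); the number of tests / the complexity of `G` never enters.] -/
def EquiRank (p : ℕ) (r : ℕ → ℕ) : Prop :=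
  ∃ ℓ₀ : ℕ, ∀ ℓ ≥ ℓ₀, ∀ d ≤ r ℓ, ∀ (Φ : Fin d → Fin ℓ → ZMod p) (G : (Fin d → ZMod p) → Bool) (b : ℕ) (s : Bool),
    24 * (univ.filter fun v : Fin ℓ → Bool => wt v % 3 = b % 3 ∧ G (fun k => ∑ j, if v j then Φ k j else 0) = s).card ≤
      8 * (univ.filter fun v : Fin ℓ → Bool => G (fun k => ∑ j, if v j then Φ k j else 0) = s).card + 2 ^ ℓ

/-- **RUNG `EquiRankLin p`** — linear rank `r(ℓ) = ℓ/E`.  [**PROVED** for every `p` coprime to `3` (§4).] -/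
def EquiRankLin (p : ℕ) : Prop := ∃ E : ℕ, 0 < E ∧ EquiRank p (fun ℓ => ℓ / E)

/-- **CONJECTURE `EquiRankSharp p`** — the dial holds at every rank fraction below `1/(p−1)`.  [UNDECIDED ·
INSTRUMENTABLE: the block sketch (§5) is the only obstruction found; why it might fail: a non-block sketch of rank
`ℓ/D`, `D ≥ p`, with constant advantage on `|v| mod 3` — none exists for `d ≤ 2`, `p ≤ 13` exactly at the
exactness level (calc/), but constant-advantage designs were not searched.] -/
def EquiRankSharp (p : ℕ) : Prop := ∀ D : ℕ, p - 1 < D → EquiRank p (fun ℓ => ℓ / D)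

/-- **CONJECTURE `ExactRankBound p`** — a sketch `Φ ∈ 𝔽_p^{d×ℓ}` through which `|v| mod 3` factors EXACTLY on
`{0,1}^ℓ` (as a function `G : 𝔽_p^d → ℕ`, `G(Φv) = |v| mod 3`) has `ℓ ≤ (p−1)·d`.  Equivalently: `ℓ > (p−1)d` columns
`φ_j ∈ 𝔽_p^d` always admit `δ ∈ {0,±1}^ℓ` with `Σ_j δ_j φ_j = 0` and `Σ_j δ_j ≢ 0 (mod 3)` (an Olson/Davenport-type
statement in `𝔽_p^d × ℤ/3`; tight by the block sketch, `block_exact`).  [UNDECIDED · INSTRUMENTABLE · machine-checked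
exhaustively (calc/exact_d1.out, calc/exact_d2.out) for `(p,d) ∈ {(2,1),(5,1),(7,1),(11,1),(13,1),(5,2)}`: the largest
exact `ℓ` is `(p−1)d` and the ONLY exact sketches there are the `GL_d(𝔽_p)`-images of the block sketch; `p = 3` is
excluded by nature (`|v| mod 3` IS one form).  The variant with only the indicator `[|v| ≡ 0]` factoring is formally
stronger and was NOT instrumented.] -/
def ExactRankBound (p : ℕ) : Prop :=
  ∀ (ℓ d : ℕ) (Φ : Fin d → Fin ℓ → ZMod p) (G : (Fin d → ZMod p) → ℕ),
    (∀ v : Fin ℓ → Bool, G (fun k => ∑ j, if v j then Φ k j else 0) = wt v % 3) → ℓ ≤ (p - 1) * d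

/-- The law is monotone in the rank bound: a smaller `r'` is a weaker demand. -/
theorem equiRank_mono {r r' : ℕ → ℕ} (h : EquiRank p r) (hle : ∀ ℓ, r' ℓ ≤ r ℓ) : EquiRank p r' := by
  obtain ⟨ℓ₀, h⟩ := h
  exact ⟨ℓ₀, fun ℓ hℓ d hd Φ G b s => h ℓ hℓ d (le_trans hd (hle ℓ)) Φ G b s⟩

end Law

/-! ### §2 Window vocabulary [g24] and the rank grade of a window (new) -/

/-- [g24] The cuts strictly inside the bit window `[a, a+m)` (cuts `a+1, …, a+m−1`) never fire. -/
def CutFree {n : ℕ} (y : Fin (n + 1) → (Fin n → Bool) → Bool) (a m : ℕ) : Prop :=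
  ∀ g : Fin (n + 1), a < g.val → g.val < a + m → ∀ u, y g u = false

section Window
variable {L ℓ R : ℕ}

/-- [g24] Cut `g` READS the window: on some outside fibre its selector distinguishes two window contents. -/
def Reads (y : Fin (L + ℓ + R + 1) → (Fin (L + ℓ + R) → Bool) → Bool) (g : Fin (L + ℓ + R + 1)) : Prop :=
  ∃ (a : Fin L → Bool) (b : Fin R → Bool) (v v' : Fin ℓ → Bool), y g (glue3 a v b) ≠ y g (glue3 a v' b)

/-- [g24] The set of cuts reading the window `[L, L+ℓ)` of `n = L + ℓ + R` bits. -/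
def readers (y : Fin (L + ℓ + R + 1) → (Fin (L + ℓ + R) → Bool) → Bool) : Finset (Fin (L + ℓ + R + 1)) :=
  univ.filter fun g => Reads y g

/-- A cut that does not read the window answers the same on any two inputs agreeing outside the window [g24]. -/
theorem not_reads {y : Fin (L + ℓ + R + 1) → (Fin (L + ℓ + R) → Bool) → Bool} {g : Fin (L + ℓ + R + 1)}
    (hg : ¬ Reads y g) (a : Fin L → Bool) (b : Fin R → Bool) (v v' : Fin ℓ → Bool) :
    y g (glue3 a v b) = y g (glue3 a v' b) := by
  by_contra h
  exact hg ⟨a, b, v, v', h⟩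

/-- **The rank grade (new).**  `RankLE p y r`: the window view of the table `y` has `𝔽_p`-SKETCH DIMENSION `≤ r` —
there are `d ≤ r` linear forms `Φ ∈ 𝔽_p^{d×ℓ}` of the window content such that on every outside fibre `(a,b)` every
selector `v ↦ y_g(a ++ v ++ b)` is some function of `Φv`.  (No linearity of the tables is assumed.) -/
def RankLE (p : ℕ) (y : Fin (L + ℓ + R + 1) → (Fin (L + ℓ + R) → Bool) → Bool) (r : ℕ) : Prop :=
  ∃ d : ℕ, d ≤ r ∧ ∃ Φ : Fin d → Fin ℓ → ZMod p,
    ∀ (g : Fin (L + ℓ + R + 1)) (a : Fin L → Bool) (b : Fin R → Bool),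
      ∃ T : (Fin d → ZMod p) → Bool, ∀ v : Fin ℓ → Bool,
        y g (glue3 a v b) = T (fun k => ∑ j, if v j then Φ k j else 0)

/-- `RankLE` is monotone in the dimension bound. -/
theorem rankLE_mono {p : ℕ} {y : Fin (L + ℓ + R + 1) → (Fin (L + ℓ + R) → Bool) → Bool} {r r' : ℕ}
    (h : RankLE p y r) (hle : r ≤ r') : RankLE p y r' := by
  obtain ⟨d, hd, Φ, hΦ⟩ := h
  exact ⟨d, le_trans hd hle, Φ, hΦ⟩

end Window

/-! ### §2bis The pieces (walk-game side) -/

section Pieces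
variable (p : ℕ) [Fact p.Prime]

/-- **PIECE `WindowRankLinSel p`** (the low-rank grade): a linear-test strategy with a cut-free window of length
`ℓ ≥ ℓ₀` whose view has `𝔽_p`-sketch dimension `≤ ℓ/E` wins on `≤ θ·2ⁿ` inputs.  [NECESSARY (`windowRank_of_r5`) ·
STRICTLY WEAKER than R5 (silent about every strategy without a low-rank cut-free window) · STRICTLY STRONGER than g24's
`WindowFewLinSel p` (`windowFew_of_windowRank`: `#readers ≤ ℓ/E ⟹ RankLE (ℓ/E)`; conversely `n + 1` readers sharing
one window form have rank `1`) · **PROVED** for every prime `p ≥ 5`: `windowRankLinSel_holds`.] -/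
def WindowRankLinSel : Prop :=
  ∃ E : ℕ, 0 < E ∧ ∃ θ : ℝ, θ < 1 ∧ ∃ ℓ₀ : ℕ, ∀ L ℓ R : ℕ, ℓ₀ ≤ ℓ →
    ∀ (c : ℕ) (y : Fin (L + ℓ + R + 1) → (Fin (L + ℓ + R) → Bool) → Bool), LinSel p y → CutFree y L ℓ →
      RankLE p y (ℓ / E) →
      ((univ.filter fun u : Fin (L + ℓ + R) → Bool => ringWinU c y u = true).card : ℝ) ≤ θ * (2 : ℝ) ^ (L + ℓ + R)

/-- **`WindowRankSel p`** — the low-rank grade for ARBITRARY selector tables (no `LinSel`), any modulus `p`.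
[**PROVED** for every `p ≥ 1` coprime to `3` (`windowRankSel_holds`); implies `WindowRankLinSel p`.] -/
def WindowRankSel (p : ℕ) : Prop :=
  ∃ E : ℕ, 0 < E ∧ ∃ θ : ℝ, θ < 1 ∧ ∃ ℓ₀ : ℕ, ∀ L ℓ R : ℕ, ℓ₀ ≤ ℓ →
    ∀ (c : ℕ) (y : Fin (L + ℓ + R + 1) → (Fin (L + ℓ + R) → Bool) → Bool), CutFree y L ℓ →
      RankLE p y (ℓ / E) →
      ((univ.filter fun u : Fin (L + ℓ + R) → Bool => ringWinU c y u = true).card : ℝ) ≤ θ * (2 : ℝ) ^ (L + ℓ + R)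

/-- **PIECE `WindowHighRankLinSel p`** (the high-rank grade): a linear-test strategy with a cut-free window of length
`ℓ ≥ C·(log₂ n + 1)` whose view has sketch dimension `> ℓ/E` wins on `≤ θ·2ⁿ` inputs (for every `E`).  [NECESSARY
(`windowHighRank_of_r5`) · STRICTLY WEAKER than R5 · WEAKER than g24's `WindowDenseLinSel p`
(`windowHighRank_of_windowDense`) · IDEA-NEEDED: above rank `ℓ/(p−1)` no equidistribution law can hold (§5), so the
fibre method ends; why it might fail as a route: it contains every long-window strategy of full window rank.] -/
def WindowHighRankLinSel : Prop :=
  ∀ E : ℕ, 0 < E → ∃ θ : ℝ, θ < 1 ∧ ∃ C : ℕ, ∃ n₀ : ℕ, ∀ L ℓ R : ℕ, n₀ ≤ L + ℓ + R →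
    C * (Nat.log 2 (L + ℓ + R) + 1) ≤ ℓ →
    ∀ (c : ℕ) (y : Fin (L + ℓ + R + 1) → (Fin (L + ℓ + R) → Bool) → Bool), LinSel p y → CutFree y L ℓ →
      ¬ RankLE p y (ℓ / E) →
      ((univ.filter fun u : Fin (L + ℓ + R) → Bool => ringWinU c y u = true).card : ℝ) ≤ θ * (2 : ℝ) ^ (L + ℓ + R)

/-- **PIECE `NoWindowLinSel p`** [verbatim g24] (the residual grade): a linear-test strategy with NO cut-free window
of length `≥ C·(log₂ n + 1)` wins on `≤ θ·2ⁿ` inputs, one `θ` for all `C`.  [NECESSARY (`noWindow_of_r5`) · STRICTLY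
WEAKER than R5 · IDEA-NEEDED: the dense core of R5.] -/
def NoWindowLinSel : Prop :=
  ∃ θ : ℝ, θ < 1 ∧ ∀ C : ℕ, ∃ n₀ : ℕ, ∀ n ≥ n₀,
    ∀ (c : ℕ) (y : Fin (n + 1) → (Fin n → Bool) → Bool), LinSel p y →
      (∀ a m : ℕ, a + m ≤ n → C * (Nat.log 2 n + 1) ≤ m → ¬ CutFree y a m) →
      ((univ.filter fun u : Fin n → Bool => ringWinU c y u = true).card : ℝ) ≤ θ * (2 : ℝ) ^ n

/-- [g24] **PIECE `WindowFewLinSel p`** (g24's readership grade, kept for comparison: implied by `WindowRankLinSel p`). -/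
def WindowFewLinSel : Prop :=
  ∃ E : ℕ, 0 < E ∧ ∃ θ : ℝ, θ < 1 ∧ ∃ ℓ₀ : ℕ, ∀ L ℓ R : ℕ, ℓ₀ ≤ ℓ →
    ∀ (c : ℕ) (y : Fin (L + ℓ + R + 1) → (Fin (L + ℓ + R) → Bool) → Bool), LinSel p y → CutFree y L ℓ →
      (readers y).card ≤ ℓ / E →
      ((univ.filter fun u : Fin (L + ℓ + R) → Bool => ringWinU c y u = true).card : ℝ) ≤ θ * (2 : ℝ) ^ (L + ℓ + R)

/-- [g24] **PIECE `WindowDenseLinSel p`** (g24's dense grade, kept for comparison: implies `WindowHighRankLinSel p`). -/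
def WindowDenseLinSel : Prop :=
  ∀ E : ℕ, 0 < E → ∃ θ : ℝ, θ < 1 ∧ ∃ C : ℕ, ∃ n₀ : ℕ, ∀ L ℓ R : ℕ, n₀ ≤ L + ℓ + R →
    C * (Nat.log 2 (L + ℓ + R) + 1) ≤ ℓ →
    ∀ (c : ℕ) (y : Fin (L + ℓ + R + 1) → (Fin (L + ℓ + R) → Bool) → Bool), LinSel p y → CutFree y L ℓ →
      ℓ / E < (readers y).card →
      ((univ.filter fun u : Fin (L + ℓ + R) → Bool => ringWinU c y u = true).card : ℝ) ≤ θ * (2 : ℝ) ^ (L + ℓ + R)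

end Pieces

/-- **PIECE `R5Odd`** (rung R5 at every odd prime `p ≥ 5`; NECESSARY for T by `r5Odd_of_target`). -/
def R5Odd : Prop := ∀ (p : ℕ) [Fact p.Prime], 5 ≤ p → WalkHardFLinSel p

/-- **PIECE `R5LiftOdd`** — the declared RESIDUAL one level up: rung R5 lifts to the target.
[RESIDUAL · ≡ T modulo `R5Odd` · COSTUME-grade as a target, not to be staffed] -/
def R5LiftOdd : Prop := R5Odd → Theses.OddPrimeWalk.ManyReadersSqrtOdd

/-! ### §3bis Readership is a sketch: the rank grade contains g24's readership grade -/

section Readers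
variable {p : ℕ} [Fact p.Prime] {L ℓ R : ℕ}

/-- [g24] A linear form evaluated on a glued input: window part plus outside part. -/
theorem linForm_glue3 (lam : Fin (L + ℓ + R) → ZMod p) (a : Fin L → Bool) (v : Fin ℓ → Bool) (b : Fin R → Bool) :
    (∑ i : Fin (L + ℓ + R), if glue3 a v b i then lam i else 0) =
      (∑ j : Fin ℓ, if v j then lam (Fin.castAdd R (Fin.natAdd L j)) else 0) +
      ((∑ i : Fin L, if a i then lam (Fin.castAdd R (Fin.castAdd ℓ i)) else 0) +
       (∑ k : Fin R, if b k then lam (Fin.natAdd (L + ℓ) k) else 0)) := by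
  rw [Fin.sum_univ_add, Fin.sum_univ_add]
  simp only [glue3, Fin.append_left, Fin.append_right]
  ring

/-- [g24] the window part of cut `g`'s linear form -/
def lamW (lam : Fin (L + ℓ + R + 1) → Fin (L + ℓ + R) → ZMod p) (g : Fin (L + ℓ + R + 1)) (j : Fin ℓ) : ZMod p :=
  lam g (Fin.castAdd R (Fin.natAdd L j))

/-- [g24] the fibre-dependent target of cut `g`'s window test -/
def rhoW (lam : Fin (L + ℓ + R + 1) → Fin (L + ℓ + R) → ZMod p) (rr : Fin (L + ℓ + R + 1) → ZMod p)
    (a : Fin L → Bool) (b : Fin R → Bool) (g : Fin (L + ℓ + R + 1)) : ZMod p :=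
  rr g - ((∑ i : Fin L, if a i then lam g (Fin.castAdd R (Fin.castAdd ℓ i)) else 0) +
          (∑ k : Fin R, if b k then lam g (Fin.natAdd (L + ℓ) k) else 0))

/-- [g24] On a fibre, a linear-test selector is an affine `𝔽_p`-test of the window content. -/
theorem linSel_glue3 (y : Fin (L + ℓ + R + 1) → (Fin (L + ℓ + R) → Bool) → Bool)
    (lam : Fin (L + ℓ + R + 1) → Fin (L + ℓ + R) → ZMod p) (rr : Fin (L + ℓ + R + 1) → ZMod p)
    (hyl : ∀ g u, y g u = decide ((∑ i, if u i then lam g i else 0) = rr g))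
    (g : Fin (L + ℓ + R + 1)) (a : Fin L → Bool) (v : Fin ℓ → Bool) (b : Fin R → Bool) :
    y g (glue3 a v b) = decide ((∑ j, if v j then lamW lam g j else 0) = rhoW lam rr a b g) := by
  rw [hyl, linForm_glue3]
  unfold lamW rhoW
  by_cases h : (∑ j : Fin ℓ, if v j then lam g (Fin.castAdd R (Fin.natAdd L j)) else 0) +
      ((∑ i : Fin L, if a i then lam g (Fin.castAdd R (Fin.castAdd ℓ i)) else 0) +
       (∑ k : Fin R, if b k then lam g (Fin.natAdd (L + ℓ) k) else 0)) = rr g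
  · rw [decide_eq_true h, decide_eq_true (eq_sub_of_add_eq h)]
  · rw [decide_eq_false h, decide_eq_false (fun h' => h (by rw [h']; abel))]

/-- **Readership is a sketch**: under `LinSel`, the readers' window forms are a sketch of dimension `#readers`
through which every selector factors on every fibre (readers: their own coordinate; non-readers: constants). -/
theorem rankLE_of_linSel (y : Fin (L + ℓ + R + 1) → (Fin (L + ℓ + R) → Bool) → Bool) (hy : LinSel p y) :
    RankLE p y (readers y).card := by
  choose lam rr hyl using hy
  refine ⟨(readers y).card, le_rfl, fun k j => lamW lam ((readers y).equivFin.symm k).1 j, fun g a b => ?_⟩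
  by_cases hg : g ∈ readers y
  · refine ⟨fun x => decide (x ((readers y).equivFin ⟨g, hg⟩) = rhoW lam rr a b g), fun v => ?_⟩
    rw [linSel_glue3 y lam rr hyl g a v b]
    simp only [Equiv.symm_apply_apply]
  · refine ⟨fun _ => y g (glue3 a (fun _ => false) b), fun v => ?_⟩
    have hng : ¬ Reads y g := by
      intro h
      exact hg (by unfold readers; rw [Finset.mem_filter]; exact ⟨Finset.mem_univ _, h⟩)
    exact not_reads hng a b v (fun _ => false)

/-- few readers ⟹ low rank -/
theorem rankLE_of_readers_le (y : Fin (L + ℓ + R + 1) → (Fin (L + ℓ + R) → Bool) → Bool) (hy : LinSel p y)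
    {r : ℕ} (h : (readers y).card ≤ r) : RankLE p y r :=
  rankLE_mono (rankLE_of_linSel y hy) h

/-- high rank ⟹ many readers -/
theorem readers_gt_of_not_rankLE (y : Fin (L + ℓ + R + 1) → (Fin (L + ℓ + R) → Bool) → Bool) (hy : LinSel p y)
    {r : ℕ} (h : ¬ RankLE p y r) : r < (readers y).card := by
  by_contra hle
  exact h (rankLE_of_readers_le y hy (not_lt.1 hle))

end Readers

end Summit.QuantumAdvantage.QuantumAdvantage.Theorems.RankDial

end
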